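import Summits.BirchSwinnertonDyer.BirchSwinnertonDyer.Theorems.SchneiderFreeAdditiveX3LocalTowerTorsionLine
import HarnessLib

/-!
# The numeric clauses of the canonical line from its divisibility (crux `LocalTowerTorsionFiniteX3`,
# stmt-BirchSwinnertonDyer-19546)

Seat `bsd-schneider-door-c5` (cell `bsd-schneider-ideate`), gen 5; route `SchneiderFreeAdditiveX3`.
The conditional stubs `stub_finV_*_of_lineCharacter` (`…LocalTowerTorsionFiniteOfLine`) take the
canonical line `C ≤ E(K̄)[p^∞]` with two numeric clauses — `#C[p] ≤ p` and "points of every order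
`p^k`" — while the tree's ramified ordinary line (n1011, `EmertonPollackWeston2006.IsRamifiedOrdinaryLine`)
records the line as DIVISIBLE, PROPER and NON-ZERO.  This file proves, for any subgroup `C` of a
`p`-primary abelian group `M` with `#M[p] = p²` (e.g. `M = E[p^∞]`, Silverman III.6.4):

* `top_le_of_pTorsion_le_of_divisible` — if `M[p] ⊆ C` and `C` is `p`-divisible then `C = M`;
* `ncard_pTorsion_le_of_divisible_of_ne_top` — `C` divisible and `C ≠ ⊤` ⇒ `#C[p] ≤ p` (Lagrange in
  `M[p]` of order `p²`, and the previous lemma excludes `#C[p] = p²`);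
* `exists_addOrderOf_eq_pow_of_divisible_of_ne_bot` — `C` divisible and `C ≠ ⊥` ⇒ `C` has points of
  every order `p^k`;
* curve level: `WeierstrassCurve.lineClauses_of_divisible` for `C ≤ E.geomPrimaryTorsion p`
  (`#E[p] = p²` from `card_torsionPoints_eq_sq_holds`).

So the numeric half of hypothesis (ii) of the conditional stubs follows from the n1011 shape of the
line; what remains of (ii) is the transport `(ℚ̄, D_v) → (K̄, D_𝔭)` and the character clause.
Proofs only (no definition, no named fact, no `sorry`); helper for stmt-BirchSwinnertonDyer-19546;
closes nothing by itself; BSD is not advanced.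

## References

* [SilvermanAEC2009] J. H. Silverman, *AEC*, Cor. III.6.4 (`E[m] ≅ (ℤ/m)²`).
* [CoatesLNM1716] J. Coates, LNM 1716 (1999), p. 31 (62) (the canonical subgroup `C ≅ ℚ_p/ℤ_p`).
-/

noncomputable section

open scoped Classical

namespace Summit.BirchSwinnertonDyer.BirchSwinnertonDyer.Theorems.SchneiderFreeAdditiveX3

open WeierstrassCurve Literature.NumberTheory.EllipticCurves

set_option linter.dupNamespace false

/-! ## §1. Generic: a divisible subgroup of a `p`-primary group with `#M[p] = p²` -/

section Generic

variable {M : Type} [AddCommGroup M] {p : ℕ} [hp : Fact p.Prime]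

omit hp in
/-- **`M[p] ⊆ C` and `C` divisible ⇒ `C = M`** for a `p`-primary `M`: by induction on the exponent,
`p^{n+1} m = 0 ⇒ p m ∈ C ⇒ p m = p c'` (`c' ∈ C`) `⇒ m − c' ∈ M[p] ⊆ C`. [folklore] -/
theorem top_le_of_pTorsion_le_of_divisible (C : AddSubgroup M)
    (htor : ∀ m : M, ∃ k : ℕ, p ^ k • m = 0)
    (hdiv : ∀ c ∈ C, ∃ c' ∈ C, p • c' = c) (h1 : ∀ m : M, p • m = 0 → m ∈ C) : C = ⊤ := by
  have key : ∀ n : ℕ, ∀ m : M, p ^ n • m = 0 → m ∈ C := by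
    intro n
    induction n with
    | zero => intro m hm; rw [pow_zero, one_smul] at hm; rw [hm]; exact C.zero_mem
    | succ n ih =>
      intro m hm
      have hpm : p • m ∈ C := ih _ (by rw [smul_smul, ← pow_succ, hm])
      obtain ⟨c', hc', hpc'⟩ := hdiv _ hpm
      have hmc : m - c' ∈ C := h1 _ (by rw [smul_sub, hpc', sub_self])
      have : m = (m - c') + c' := (sub_add_cancel m c').symm
      rw [this]
      exact C.add_mem hmc hc'
  rw [eq_top_iff]
  intro m _
  obtain ⟨k, hk⟩ := htor m
  exact key k m hk

/-- **A proper divisible subgroup has at most `p` points killed by `p`** when `#M[p] = p²`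
(`M` `p`-primary): `C[p] ≤ M[p]` has order `1`, `p` or `p²` (Lagrange), and `p²` would give `M[p] ⊆ C`,
hence `C = M`. [folklore] -/
theorem ncard_pTorsion_le_of_divisible_of_ne_top (C : AddSubgroup M)
    (htor : ∀ m : M, ∃ k : ℕ, p ^ k • m = 0)
    (hM1 : Set.ncard {m : M | p • m = 0} = p ^ 2)
    (hdiv : ∀ c ∈ C, ∃ c' ∈ C, p • c' = c) (htop : C ≠ ⊤) :
    Set.ncard {c : M | c ∈ C ∧ p • c = 0} ≤ p := by
  -- the subgroups `V = M[p]` and `C₁ = C ∩ M[p]`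
  let V : AddSubgroup M :=
    { carrier := {m | p • m = 0}
      add_mem' := fun {a b} ha hb ↦ by
        simp only [Set.mem_setOf_eq] at ha hb ⊢; rw [smul_add, ha, hb, add_zero]
      zero_mem' := smul_zero _
      neg_mem' := fun {a} ha ↦ by simp only [Set.mem_setOf_eq] at ha ⊢; rw [smul_neg, ha, neg_zero] }
  have hVmem : ∀ m : M, m ∈ V ↔ p • m = 0 := fun m ↦ Iff.rfl
  have hVset : (V : Set M) = {m : M | p • m = 0} := rfl
  have hVfin : (V : Set M).Finite := by
    rw [hVset]; apply Set.finite_of_ncard_pos; rw [hM1]; exact pow_pos hp.out.pos 2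
  haveI : Finite V := hVfin.to_subtype
  have hVcard : Nat.card V = p ^ 2 := by
    rw [← hVset, ← Nat.card_coe_set_eq] at hM1; exact hM1
  let C₁ : AddSubgroup M := C ⊓ V
  have hC₁set : (C₁ : Set M) = {c : M | c ∈ C ∧ p • c = 0} := by
    ext m
    rw [SetLike.mem_coe, AddSubgroup.mem_inf, hVmem]
    rfl
  have hle : C₁ ≤ V := inf_le_right
  haveI : Finite C₁ := Finite.of_injective _ (AddSubgroup.inclusion_injective hle)
  have hdvd : Nat.card C₁ ∣ p ^ 2 := hVcard ▸ AddSubgroup.card_dvd_of_le hle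
  obtain ⟨i, hi2, hi⟩ := (Nat.dvd_prime_pow hp.out).mp hdvd
  rw [← hC₁set, ← Nat.card_coe_set_eq, SetLike.coe_sort_coe, hi]
  -- `i ≤ 1`: `i = 2` would force `C₁ = V`, `M[p] ⊆ C`, `C = ⊤`
  have hi1 : i ≤ 1 := by
    by_contra hgt
    have hi2' : i = 2 := by omega
    have heq : C₁ = V := AddSubgroup.eq_of_le_of_card_ge hle (by rw [hi, hi2', hVcard])
    refine htop (top_le_of_pTorsion_le_of_divisible C htor hdiv fun m hm ↦ ?_)
    have : m ∈ C₁ := by rw [heq]; exact (hVmem m).mpr hm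
    exact (AddSubgroup.mem_inf.mp this).1
  calc p ^ i ≤ p ^ 1 := Nat.pow_le_pow_right hp.out.pos hi1
    _ = p := pow_one p

/-- **A non-zero divisible subgroup of a `p`-primary group has points of every order `p^k`**:
a non-zero `c ∈ C` is `p^{k}`-divisible inside `C`, `c = p^k c_k`, and a suitable multiple of `c_k`
has order exactly `p^k`. [folklore] -/
theorem exists_addOrderOf_eq_pow_of_divisible_of_ne_bot (C : AddSubgroup M)
    (htor : ∀ m : M, ∃ k : ℕ, p ^ k • m = 0)
    (hdiv : ∀ c ∈ C, ∃ c' ∈ C, p • c' = c) (hbot : C ≠ ⊥) (k : ℕ) :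
    ∃ c ∈ C, addOrderOf c = p ^ k := by
  rcases k with _ | k
  · exact ⟨0, C.zero_mem, by rw [pow_zero, addOrderOf_zero]⟩
  obtain ⟨c, hcC, hc0⟩ : ∃ c ∈ C, c ≠ 0 := by
    by_contra h
    push Not at h
    exact hbot ((AddSubgroup.eq_bot_iff_forall _).mpr h)
  -- `c = p^k • x` with `x ∈ C`
  have hdivk : ∀ n : ℕ, ∃ x ∈ C, p ^ n • x = c := by
    intro n
    induction n with
    | zero => exact ⟨c, hcC, by rw [pow_zero, one_smul]⟩
    | succ n ih =>
      obtain ⟨x, hxC, hx⟩ := ih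
      obtain ⟨x', hx'C, hx'⟩ := hdiv x hxC
      exact ⟨x', hx'C, by rw [pow_succ, mul_smul, hx', hx]⟩
  obtain ⟨x, hxC, hx⟩ := hdivk k
  obtain ⟨K₀, hK₀⟩ := htor x
  have hxk : p ^ k • x ≠ 0 := by rw [hx]; exact hc0
  obtain ⟨i, hi1, hi0⟩ := exists_nsmul_order_layer (p := p) hK₀ hxk
  exact ⟨p ^ i • x, C.nsmul_mem hxC _, addOrderOf_eq_prime_pow hi0 hi1⟩

end Generic

/-! ## §2. The curve: `C ≤ E[p^∞]` divisible, proper, non-zero -/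

section Curve

variable {K : Type} [Field K] [NumberField K] (E : WeierstrassCurve K) [E.IsElliptic] {p : ℕ}
  [hp : Fact p.Prime]

/-- `#E[p^∞][p] = p²`: the points of `E(K̄)[p^∞]` killed by `p` are `E[p]`, of order `p²`
(Silverman III.6.4 in the tree: `card_torsionPoints_eq_sq_holds`). [cite: SilvermanAEC2009, Cor. III.6.4] -/
theorem ncard_geomPrimaryTorsion_pTorsion_eq_sq :
    Set.ncard {m : E.geomPrimaryTorsion p | p • m = 0} = p ^ 2 := by
  have hp0 : (p : K) ≠ 0 := Nat.cast_ne_zero.mpr hp.out.ne_zero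
  have hcard : Nat.card (E.geomTorsion (p ^ 1 : ℕ)) = p ^ (2 * 1) :=
    card_geomTorsion_pow_eq E p (card_torsionPoints_eq_sq_holds E (AlgebraicClosure K)) hp0 1
  rw [pow_one, mul_one] at hcard
  rw [← hcard, ← Nat.card_coe_set_eq]
  -- bijection `{m ∈ E[p^∞] | p m = 0} ≃ E[p]`
  refine Nat.card_congr
    { toFun := fun m ↦ ⟨(m.1 : E.geomPoints), AddSubgroup.torsionBy.nsmul_iff.mpr (by
        rw [← AddSubgroupClass.coe_nsmul, m.2, ZeroMemClass.coe_zero])⟩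
      invFun := fun P ↦ ⟨⟨(P : E.geomPoints), ⟨1, by
        rw [pow_one]; exact AddSubgroup.torsionBy.nsmul_iff.mp P.2⟩⟩, Subtype.ext (by
        rw [AddSubgroupClass.coe_nsmul, ZeroMemClass.coe_zero]
        exact AddSubgroup.torsionBy.nsmul_iff.mp P.2)⟩
      left_inv := fun m ↦ by ext; rfl
      right_inv := fun P ↦ by ext; rfl }

/-- **The numeric clauses of the canonical line from the n1011 shape.**  For a DIVISIBLE, PROPER,
NON-ZERO subgroup `C ≤ E(K̄)[p^∞]` (the first three clauses of `IsRamifiedOrdinaryLine`; Coates'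
canonical subgroup `C ≅ ℚ_p/ℤ_p`): `#C[p] ≤ p` and `C` has points of every order `p^k` — the two
numeric clauses of hypothesis (ii) of `stub_finV_*_of_lineCharacter`. [cite: CoatesLNM1716, p. 31 (62)] -/
theorem _root_.WeierstrassCurve.lineClauses_of_divisible (C : AddSubgroup (E.geomPrimaryTorsion p))
    (hdiv : ∀ c ∈ C, ∃ c' ∈ C, p • c' = c) (htop : C ≠ ⊤) (hbot : C ≠ ⊥) :
    Set.ncard {c : E.geomPrimaryTorsion p | c ∈ C ∧ p • c = 0} ≤ p ∧
      ∀ k : ℕ, ∃ c ∈ C, addOrderOf c = p ^ k := by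
  have htor : ∀ x : E.geomPrimaryTorsion p, ∃ k : ℕ, p ^ k • x = 0 := fun x ↦ by
    obtain ⟨k, hk⟩ := x.2
    exact ⟨k, Subtype.ext (by rw [AddSubgroupClass.coe_nsmul, hk]; rfl)⟩
  exact ⟨ncard_pTorsion_le_of_divisible_of_ne_top C htor (ncard_geomPrimaryTorsion_pTorsion_eq_sq E)
      hdiv htop,
    exists_addOrderOf_eq_pow_of_divisible_of_ne_bot C htor hdiv hbot⟩

end Curve

end Summit.BirchSwinnertonDyer.BirchSwinnertonDyer.Theorems.SchneiderFreeAdditiveX3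

end
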